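import Literature.MathematicalPhysics.QuantumFieldTheory.Balaban1983to89.B8Thm2TorusMemberWeighted
import Literature.MathematicalPhysics.QuantumFieldTheory.Balaban1983to89.B9CubeGeometryInputs

/-!
# `Balaban1983to89.B8Thm2TorusMemberCatalogueThresholds` — sub-row G-B8-T2S, file G1: THE MEMBER CATALOGUE OF THE [B8] THM 2 TORUS ASSEMBLER
# ABOVE ALL THREE PRINTED THRESHOLDS — [Balaban1985BackgroundPropagators] Thm 3.1 p. 397 «for M ≥ M₁» ∕ Thm 3.7 p. 410 «for M sufficiently large»
# (`M₀ ≤ L·M_h`) AND [Balaban1984PropagatorsII] Lemma 2.1 p. 234 «for RM satisfying (2.59)» (`N₀ + 1 ≤ R·(L·M_h)`, `T₀ ≤ R·L·M_h − 1`) — in EXACTLY the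
# clause shape of seat p33's FILE 16 `B8Thm2TorusKnitOfCubeData.thm2SetupSUAt_ofCubeData_exists` (its OFFER (β): «t2s-1 A11 lineage — a catalogue with the
# R·M thresholds; `exists_catalogue` controls M only»)

statement-level skeleton of published theorems with citation tags; proofs where landed; nothing here is a claim about the
Yang–Mills mass gap

T. Bałaban, *Propagators and renormalization transformations for lattice gauge theories. II*, Commun. Math. Phys. **96** (1984) 223–250
[Balaban1984PropagatorsII]: (2.1)–(2.4) p. 224 (the sequence of block lattices `T^{(j)}_{L^jη}`, domains `Ω_j`, big blocks of size `M = L·M_h`), (2.16) p. 225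
(the weights `a` in the band), Lemma 2.1 (2.59)–(2.61) pp. 233–234 («for RM satisfying (2.59)»).  T. Bałaban, *Propagators for lattice gauge theories in a
background field*, Commun. Math. Phys. **99** (1985) 389–434 [Balaban1985BackgroundPropagators]: Thm 3.1 p. 397 («There exist constants M₁, δ₀ > 0, B₀ … for
M ≥ M₁»), Thm 3.7 p. 410 («for M sufficiently large»), Thm 3.9 p. 413, (3.16) p. 393 (print's units `c_f`).  T. Bałaban, *Spaces of regular gauge field
configurations on a lattice and gauge fixing conditions*, Commun. Math. Phys. **99** (1985) 75–102 [Balaban1985RegularSpaces]: Thm 2 p. 83, p. 77 («Ω_j = T_η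
for j = 0,1,…,l, l ≤ k»).  T. Bałaban, *Averaging operations for lattice gauge theories*, Commun. Math. Phys. **98** (1985) 17–51 [Balaban1985Averaging]: (4)
p. 18 (the torus of `L^k`-blocks).

WHY.  FILE 16 (p33 g100, p656834) proves [B8] Thm 2 on `T_η` for `SU(N)` from three displayed families: (i) a member catalogue `memF k P n` with sections `ιBF`
meeting the clauses «period `P`, constant level `n`, `M₀ ≤ L·M_h`, `N₀ + 1 ≤ R·(L·M_h)`, `T₀ ≤ R·L·M_h − 1` (`B9CubeGeometryInputs.RM1`), `c_f = L^k`, nominal index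
`k ≤ n + e_s`, `ιBF` a section of `β`», (ii) per-cube (3.35) data, (iii) the (B)-lines.  Seat t2s-1's catalogue A11
`B8Thm2TorusMemberCatalogue.exists_catalogue` (and g7's weighted form `B8Thm2TorusMemberWeighted.exists_constLev_member_weight`) serves the `M`-threshold only.
THIS FILE serves all three thresholds at once, with the SAME members (big blocks `M_h = L^a`, `R = 2L²`): since `R ≥ 1`, the two `R·M`-clauses are met by
enlarging the big-block exponent `a` alone (`B6KLevelFamilyWitnessV1.exists_exponent`), so the catalogue is g7's weighted constant-level member at a larger `a`,
chosen ONCE from `(M₀, T₀, N₀)` — independent of the volume (the located volume threshold is `n + (a + 3) ≤ m + K`).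

WHAT IS PROVED (kernel; 0 `def`, 0 `… : Prop` fact, 0 sorry; standard axioms).
* §1 `exists_exponent_thresholds` — the arithmetic: `∃ a, 8 ≤ L^a ∧ M₀ ≤ L·L^a ∧ N₀ + 1 ≤ 2L²·(L·L^a) ∧ T₀ ≤ ((2L²·(L·L^a) − 1 : ℕ) : ℝ)`.
* §2 ★★ `exists_catalogue_thresholds` — for odd `L = ℓ + 1 ≥ 5`, band `0 < b₀ ≤ b₁` and ANY thresholds `M₀ T₀ : ℝ`, `N₀ : ℕ`: `∃ a k₀ mem ιBm`, `L^a ≥ 8`,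
  `k₀ = a + 3`, such that for every Setup torus `PV d ℓ m K` (period `P₀ = 2L^{m+K}`) and every level `1 ≤ n` with `n + k₀ ≤ m + K`, the member `mem P₀ n` has
  `m`-field `m + K`, `K`-field `0`, nominal index `n + 1`, `M_h = L^a`, `c_f = L^{n+1}`, constant level `n`, the weights of record
  `w ι = c_f²·b₀·(L^{j(ι)})^{d+1}·(L^{−j(ι)})²`, the three thresholds `M₀ ≤ L·M_h`, `N₀ + 1 ≤ R·(L·M_h)`, `T₀ ≤ RM1`, and `ιBm P₀ n` is a section of its `β`.
* §3 ★★ `exists_catalogueF16` — THE SAME IN FILE 16's BINDER SHAPE: `∃ a k₀ memF ιBF, L^a ≥ 8 ∧ k₀ = a + 3 ∧ ∀ m K k, 1 ≤ k → k + k₀ ≤ m + K →` a SHAPE group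
  (constant level, `k = n + 1`, `M_h = L^a`, `c_f = L^{n+1}`, period, weights) and the three clause groups of `thm2SetupSUAt_ofCubeData_exists` at `P = P₀`
  and `e_s = 1` (period ∕ `levY ≡ n` ∕ thresholds + `c_f` + `k ≤ n + 1` + section), verbatim.

HONEST SCOPE.  Bookkeeping over landed theorems (g7's member, p22/r03's `exists_exponent`); NO estimate of [B8] ∕ [B9] ∕ [4] is proved or used; the thresholds are
PARAMETERS (print's «M sufficiently large», «RM satisfying (2.59)» — whichever values FILES 12–15 produce); the located volume threshold `k + k₀ ≤ m + K` stands
(a member of nominal index `n + 1` with big blocks `L^a` and `P′ ≥ L` per direction lives on tori of at least `2L^{n+a+3}` sites); count-neutral; `stub_PV3A` NOT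
discharged; nothing continuum ∕ ℝ⁴ ∕ OS ∕ mass-gap ∕ Clay — the Yang–Mills mass gap is NOT proved by any of this.  No `sorry`, no `axiom`, no `def`, no
`instance`, no `notation`.  NEW file; nothing landed is modified.  Cell `lit-balaban`, seat `lit-balaban-t2s-1` gen 9, 2026-08-28; `--supports
stmt-QuantumFields-19200`.
-/

noncomputable section

open scoped BigOperators

namespace Literature.MathematicalPhysics.QuantumFieldTheory.Balaban1983to89.B8Thm2TorusMemberCatalogueThresholds

open Node00 B6KLevelCensusIndexV1
open B6GlobalChartV1 (PV)
open B6KLevelFamilyWitnessV1 (exists_exponent)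
open B6Ineq2142KLevelV1 (β)
open B9CubeGeometryInputs (RM1)
open B8Thm2TorusMemberCatalogue (period_eq exponent_eq_of_period_eq)
open B8Thm2TorusMemberWeighted (exists_constLev_member_weight)

variable {d ℓ : ℕ} {hd : 1 ≤ d + 1} {hL : Odd (ℓ + 1) ∧ 1 < ℓ + 1} {b₀ b₁ : ℝ}

/-! ## §1 The arithmetic of the three thresholds -/

/-- **ONE BIG-BLOCK EXPONENT ABOVE ALL THREE THRESHOLDS** at `R = 2L²`: `8 ≤ L^a`, `M₀ ≤ L·L^a`, `N₀ + 1 ≤ 2L²·(L·L^a)` and `T₀ ≤ 2L²·(L·L^a) − 1` (the last as a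
real number after the natural subtraction, as in `B9CubeGeometryInputs.RM1`).
[cite: Balaban1985BackgroundPropagators, Thm 3.1 p.397 («for M ≥ M₁»); Balaban1984PropagatorsII, Lemma 2.1 p.234 («for RM satisfying (2.59)»), bookkeeping] -/
theorem exists_exponent_thresholds (ℓ : ℕ) (hℓ : 2 ≤ ℓ) (M₀ T₀ : ℝ) (N₀ : ℕ) :
    ∃ a : ℕ, 8 ≤ (ℓ + 1) ^ a ∧ M₀ ≤ ((ℓ : ℝ) + 1) * (((ℓ + 1) ^ a : ℕ) : ℝ) ∧ N₀ + 1 ≤ 2 * (ℓ + 1) ^ 2 * ((ℓ + 1) * (ℓ + 1) ^ a) ∧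
      T₀ ≤ ((2 * (ℓ + 1) ^ 2 * ((ℓ + 1) * (ℓ + 1) ^ a) - 1 : ℕ) : ℝ) := by
  obtain ⟨a, h8, hM, hN⟩ := exists_exponent ℓ hℓ (max M₀ (T₀ + 1)) N₀ (2 * (ℓ + 1) ^ 2) (by nlinarith)
  refine ⟨a, h8, (le_max_left _ _).trans hM, hN, ?_⟩
  have hT : T₀ + 1 ≤ ((ℓ : ℝ) + 1) * (((ℓ + 1) ^ a : ℕ) : ℝ) := (le_max_right _ _).trans hM
  have h1 : 1 ≤ 2 * (ℓ + 1) ^ 2 * ((ℓ + 1) * (ℓ + 1) ^ a) := by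
    have : 1 ≤ (ℓ + 1) ^ a := Nat.one_le_pow _ _ (Nat.succ_pos ℓ)
    nlinarith
  have hle : (ℓ + 1) * (ℓ + 1) ^ a ≤ 2 * (ℓ + 1) ^ 2 * ((ℓ + 1) * (ℓ + 1) ^ a) :=
    Nat.le_mul_of_pos_left _ (by positivity)
  rw [Nat.cast_sub h1]
  have hc : (((ℓ + 1) * (ℓ + 1) ^ a : ℕ) : ℝ) = ((ℓ : ℝ) + 1) * (((ℓ + 1) ^ a : ℕ) : ℝ) := by push_cast; ring
  have hle' : ((ℓ : ℝ) + 1) * (((ℓ + 1) ^ a : ℕ) : ℝ) ≤ ((2 * (ℓ + 1) ^ 2 * ((ℓ + 1) * (ℓ + 1) ^ a) : ℕ) : ℝ) := by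
    rw [← hc]; exact_mod_cast hle
  push_cast at hT hle' ⊢
  linarith

/-! ## §2 ★★ The catalogue above the three thresholds -/

/-- ★★ **THE MEMBER CATALOGUE OF THE TORUS ASSEMBLER ABOVE ALL THREE PRINTED THRESHOLDS** (by choice, from g7's weighted constant-level member at the exponent of §1):
for odd `L = ℓ + 1 ≥ 5`, band `0 < b₀ ≤ b₁` and ANY `M₀ T₀ : ℝ`, `N₀ : ℕ` there are a big-block exponent `a` (`L^a ≥ 8`), `k₀ = a + 3`, members `mem P n` and sections `ιBm P n`
such that for every Setup torus `PV d ℓ m K` (period `P₀ = 2L^{m+K}`) and every level `1 ≤ n` with `n + k₀ ≤ m + K`: `mem P₀ n` has `m`-field `m + K`,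
`K`-field `0`, nominal index `n + 1`, `M_h = L^a`, `c_f = L^{n+1}`, constant level `n`, the weights of record, `M₀ ≤ L·M_h`, `N₀ + 1 ≤ R·(L·M_h)`, `T₀ ≤ RM1`,
and `ιBm P₀ n` is a section of `β` (the `R`-clauses from the V1 inequality `R ≥ 2L²` of every member and §1's choice of `a`).
[cite: Balaban1984PropagatorsII, (2.1)–(2.4) p.224, (2.16) p.225, Lemma 2.1 p.234 («for RM satisfying (2.59)»); Balaban1985BackgroundPropagators, Thm 3.1 p.397 («for M ≥ M₁»), Thm 3.7 p.410, (3.16) p.393; Balaban1985Averaging, (4) p.18] -/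
theorem exists_catalogue_thresholds (hℓ : 4 ≤ ℓ) (hb₀ : 0 < b₀) (hb₁ : b₀ ≤ b₁) (M₀ T₀ : ℝ) (N₀ : ℕ) :
    ∃ (a k₀ : ℕ) (mem : ℤ → ℕ → KIdx d ℓ hd hL b₀ b₁) (ιBm : ∀ P n, BlkY (mem P n) → IBondY (mem P n)), 8 ≤ (ℓ + 1) ^ a ∧ k₀ = a + 3 ∧
      ∀ (m K n : ℕ), 1 ≤ n → n + k₀ ≤ m + K →
        (mem (((PV d ℓ m K hd hL).sitesPerDir 0 : ℕ) : ℤ) n).m = m + K ∧ (mem (((PV d ℓ m K hd hL).sitesPerDir 0 : ℕ) : ℤ) n).K = 0 ∧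
        (mem (((PV d ℓ m K hd hL).sitesPerDir 0 : ℕ) : ℤ) n).k = n + 1 ∧
        (mem (((PV d ℓ m K hd hL).sitesPerDir 0 : ℕ) : ℤ) n).Mh = (ℓ + 1) ^ a ∧
        (mem (((PV d ℓ m K hd hL).sitesPerDir 0 : ℕ) : ℤ) n).cf = (((ℓ + 1 : ℕ) : ℝ)) ^ (mem (((PV d ℓ m K hd hL).sitesPerDir 0 : ℕ) : ℤ) n).k ∧
        (∀ x, (mem (((PV d ℓ m K hd hL).sitesPerDir 0 : ℕ) : ℤ) n).D.lev x = n) ∧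
        (∀ ι, (mem (((PV d ℓ m K hd hL).sitesPerDir 0 : ℕ) : ℤ) n).w ι =
          (mem (((PV d ℓ m K hd hL).sitesPerDir 0 : ℕ) : ℤ) n).cf ^ 2 *
            (b₀ * ((((ℓ + 1 : ℕ) : ℝ)) ^ (ι.1.1 : ℕ)) ^ (d + 1) * (1 / (((ℓ + 1 : ℕ) : ℝ)) ^ (ι.1.1 : ℕ)) ^ 2)) ∧
        M₀ ≤ ((ℓ : ℝ) + 1) * (toKT (mem (((PV d ℓ m K hd hL).sitesPerDir 0 : ℕ) : ℤ) n)).Mh ∧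
        N₀ + 1 ≤ (toKT (mem (((PV d ℓ m K hd hL).sitesPerDir 0 : ℕ) : ℤ) n)).R *
          ((ℓ + 1) * (toKT (mem (((PV d ℓ m K hd hL).sitesPerDir 0 : ℕ) : ℤ) n)).Mh) ∧
        T₀ ≤ RM1 (mem (((PV d ℓ m K hd hL).sitesPerDir 0 : ℕ) : ℤ) n) ∧
        ∀ t, β (mem (((PV d ℓ m K hd hL).sitesPerDir 0 : ℕ) : ℤ) n).hN (mem (((PV d ℓ m K hd hL).sitesPerDir 0 : ℕ) : ℤ) n).D
          (mem (((PV d ℓ m K hd hL).sitesPerDir 0 : ℕ) : ℤ) n).hk (ιBm (((PV d ℓ m K hd hL).sitesPerDir 0 : ℕ) : ℤ) n t) = t := by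
  classical
  obtain ⟨a, h8, hMa, hNa, hTa⟩ := exists_exponent_thresholds ℓ (by omega) M₀ T₀ N₀
  -- for every `(P, n)`: a member with `β` onto, which is the prescribed one whenever `P = 2L^T` with `n + (a+3) ≤ T`
  have hall : ∀ (P : ℤ) (n : ℕ), ∃ i : KIdx d ℓ hd hL b₀ b₁, Function.Surjective (β i.hN i.D i.hk) ∧
      ∀ T : ℕ, P = ((2 * (ℓ + 1) ^ T : ℕ) : ℤ) → 1 ≤ n → n + (a + 3) ≤ T →
        i.m = T ∧ i.K = 0 ∧ i.k = n + 1 ∧ i.Mh = (ℓ + 1) ^ a ∧ i.cf = (((ℓ + 1 : ℕ) : ℝ)) ^ i.k ∧ (∀ x, i.D.lev x = n) ∧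
        ∀ ι, i.w ι = i.cf ^ 2 * (b₀ * ((((ℓ + 1 : ℕ) : ℝ)) ^ (ι.1.1 : ℕ)) ^ (d + 1) * (1 / (((ℓ + 1 : ℕ) : ℝ)) ^ (ι.1.1 : ℕ)) ^ 2) := by
    intro P n
    by_cases h : ∃ T : ℕ, P = ((2 * (ℓ + 1) ^ T : ℕ) : ℤ) ∧ 1 ≤ n ∧ n + (a + 3) ≤ T
    · obtain ⟨T, hP, hn, hT⟩ := h
      obtain ⟨i, him, hiK, hik, hiMh, hicf, hiD, hsurj, hiw⟩ :=
        exists_constLev_member_weight (d := d) (hd := hd) (hL := hL) hℓ hb₀ hb₁ (T := T) (s := T - (n + a + 2)) hn h8 (by omega) (by omega)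
      refine ⟨i, hsurj, fun T' hP' _ _ => ?_⟩
      have hTT' : T = T' := exponent_eq_of_period_eq (by omega) (hP.symm.trans hP')
      subst hTT'
      exact ⟨him, hiK, hik, hiMh, hicf, hiD, hiw⟩
    · -- a default member (level 1, `a = 2`, `s = 1`) with `β` onto; the spec premise is then contradictory
      have h8' : 8 ≤ (ℓ + 1) ^ 2 := by nlinarith
      obtain ⟨i, -, -, -, -, -, -, hsurj, -⟩ :=
        exists_constLev_member_weight (d := d) (hd := hd) (hL := hL) hℓ hb₀ hb₁ (T := 6) (n := 1) (a := 2) (s := 1) le_rfl h8' le_rfl rfl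
      exact ⟨i, hsurj, fun T hP hn hT => (h ⟨T, hP, hn, hT⟩).elim⟩
  choose mem hsurj hspec using hall
  refine ⟨a, a + 3, mem, fun P n => Function.surjInv (hsurj P n), h8, rfl, fun m K n hn hT => ?_⟩
  have hP := period_eq (d := d) (hd := hd) (hL := hL) m K
  generalize (((PV d ℓ m K hd hL).sitesPerDir 0 : ℕ) : ℤ) = P₀ at hP ⊢
  obtain ⟨him, hiK, hik, hiMh, hicf, hiD, hiw⟩ := hspec P₀ n (m + K) hP hn hT
  -- the `R`-clauses: every member has `R ≥ 2L²` (the V1 inequality `hR2`), and `a` was chosen for `R = 2L²`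
  have hR : 2 * (ℓ + 1) ^ 2 ≤ (toKT (mem P₀ n)).R := (mem P₀ n).hR2
  have hMh : (toKT (mem P₀ n)).Mh = (ℓ + 1) ^ a := hiMh
  have hRM : 2 * (ℓ + 1) ^ 2 * ((ℓ + 1) * (ℓ + 1) ^ a) ≤ (toKT (mem P₀ n)).R * ((ℓ + 1) * (toKT (mem P₀ n)).Mh) := by
    rw [hMh]; exact Nat.mul_le_mul_right _ hR
  refine ⟨him, hiK, hik, hiMh, hicf, hiD, hiw, ?_, hNa.trans hRM, ?_, fun t => Function.surjInv_eq (hsurj _ n) t⟩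
  · -- `M = L·M_h = L^{a+1} ≥ M₀`
    rw [hMh]; exact hMa
  · -- `T₀ ≤ 2L²·L·L^a − 1 ≤ R·L·M_h − 1`
    unfold RM1
    refine hTa.trans ?_
    exact_mod_cast Nat.sub_le_sub_right hRM 1

/-! ## §3 ★★ The catalogue in FILE 16's binder shape -/

/-- ★★ **THE CATALOGUE IN FILE 16's BINDER SHAPE** (`B8Thm2TorusKnitOfCubeData.thm2SetupSUAt_ofCubeData_exists`, clause groups «period», «`levY ≡ n`», «thresholds +
`c_f = L^k` + `k ≤ n + e_s` + section» at `e_s = 1`), for EVERY torus `PV d ℓ m K` (`P = P₀ = 2L^{m+K}`) and every number of levels `1 ≤ k` with `k + k₀ ≤ m + K`: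
the three groups hold for all members `memF k P₀ n`, `n ≤ k` (the catalogue does not depend on `k`), preceded by a SHAPE group for the member-generic
suppliers of the two analytic families (constant level `n`, nominal index `n + 1`, `M_h = L^a`, `c_f = L^{n+1}`, period `P₀`, weights of record).
[cite: Balaban1984PropagatorsII, (2.1)–(2.4) p.224, Lemma 2.1 p.234; Balaban1985BackgroundPropagators, Thm 3.1 p.397, Thm 3.7 p.410, Thm 3.9 p.413; Balaban1985RegularSpaces, Thm 2 p.83, p.77 («Ω_j = T_η»); Balaban1985Averaging, (4) p.18] -/
theorem exists_catalogueF16 (hℓ : 4 ≤ ℓ) (hb₀ : 0 < b₀) (hb₁ : b₀ ≤ b₁) (M₀ T₀ : ℝ) (N₀ : ℕ) :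
    ∃ (a k₀ : ℕ) (memF : ℕ → ℤ → ℕ → KIdx d ℓ hd hL b₀ b₁) (ιBF : ∀ k P n, BlkY (memF k P n) → IBondY (memF k P n)),
      8 ≤ (ℓ + 1) ^ a ∧ k₀ = a + 3 ∧
      ∀ (m K k : ℕ), 1 ≤ k → k + k₀ ≤ m + K →
        (∀ n, 1 ≤ n → n ≤ k →
          (∀ x, (memF k (((PV d ℓ m K hd hL).sitesPerDir 0 : ℕ) : ℤ) n).D.lev x = n) ∧
          (memF k (((PV d ℓ m K hd hL).sitesPerDir 0 : ℕ) : ℤ) n).k = n + 1 ∧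
          (memF k (((PV d ℓ m K hd hL).sitesPerDir 0 : ℕ) : ℤ) n).Mh = (ℓ + 1) ^ a ∧
          (memF k (((PV d ℓ m K hd hL).sitesPerDir 0 : ℕ) : ℤ) n).cf = (((ℓ + 1 : ℕ) : ℝ)) ^ (n + 1) ∧
          (PV d ℓ (memF k (((PV d ℓ m K hd hL).sitesPerDir 0 : ℕ) : ℤ) n).m (memF k (((PV d ℓ m K hd hL).sitesPerDir 0 : ℕ) : ℤ) n).K
              hd hL).sitesPerDir 0 = (PV d ℓ m K hd hL).sitesPerDir 0 ∧
          ∀ ι, (memF k (((PV d ℓ m K hd hL).sitesPerDir 0 : ℕ) : ℤ) n).w ι =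
            (memF k (((PV d ℓ m K hd hL).sitesPerDir 0 : ℕ) : ℤ) n).cf ^ 2 *
              (b₀ * ((((ℓ + 1 : ℕ) : ℝ)) ^ (ι.1.1 : ℕ)) ^ (d + 1) * (1 / (((ℓ + 1 : ℕ) : ℝ)) ^ (ι.1.1 : ℕ)) ^ 2)) ∧
        (∀ n, 1 ≤ n → n ≤ k →
          (((PV d ℓ (memF k (((PV d ℓ m K hd hL).sitesPerDir 0 : ℕ) : ℤ) n).m
              (memF k (((PV d ℓ m K hd hL).sitesPerDir 0 : ℕ) : ℤ) n).K hd hL).sitesPerDir 0 : ℕ) : ℤ) =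
            (((PV d ℓ m K hd hL).sitesPerDir 0 : ℕ) : ℤ)) ∧
        (∀ n, 1 ≤ n → n ≤ k → ∀ z : SiteY (memF k (((PV d ℓ m K hd hL).sitesPerDir 0 : ℕ) : ℤ) n),
          levY (memF k (((PV d ℓ m K hd hL).sitesPerDir 0 : ℕ) : ℤ) n) z = n) ∧
        (∀ n, 1 ≤ n → n ≤ k →
          M₀ ≤ ((ℓ : ℝ) + 1) * (toKT (memF k (((PV d ℓ m K hd hL).sitesPerDir 0 : ℕ) : ℤ) n)).Mh ∧
          N₀ + 1 ≤ (toKT (memF k (((PV d ℓ m K hd hL).sitesPerDir 0 : ℕ) : ℤ) n)).R *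
            ((ℓ + 1) * (toKT (memF k (((PV d ℓ m K hd hL).sitesPerDir 0 : ℕ) : ℤ) n)).Mh) ∧
          T₀ ≤ RM1 (memF k (((PV d ℓ m K hd hL).sitesPerDir 0 : ℕ) : ℤ) n) ∧
          (memF k (((PV d ℓ m K hd hL).sitesPerDir 0 : ℕ) : ℤ) n).cf =
            (((ℓ + 1 : ℕ) : ℝ)) ^ (memF k (((PV d ℓ m K hd hL).sitesPerDir 0 : ℕ) : ℤ) n).k ∧
          (memF k (((PV d ℓ m K hd hL).sitesPerDir 0 : ℕ) : ℤ) n).k ≤ n + 1 ∧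
          ∀ s, β (memF k (((PV d ℓ m K hd hL).sitesPerDir 0 : ℕ) : ℤ) n).hN (memF k (((PV d ℓ m K hd hL).sitesPerDir 0 : ℕ) : ℤ) n).D
            (memF k (((PV d ℓ m K hd hL).sitesPerDir 0 : ℕ) : ℤ) n).hk (ιBF k (((PV d ℓ m K hd hL).sitesPerDir 0 : ℕ) : ℤ) n s) = s) := by
  obtain ⟨a, k₀, mem, ιBm, h8, hk₀, H⟩ := exists_catalogue_thresholds (d := d) (hd := hd) (hL := hL) hℓ hb₀ hb₁ M₀ T₀ N₀
  have hper : ∀ m K n, 1 ≤ n → n + k₀ ≤ m + K →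
      (PV d ℓ (mem (((PV d ℓ m K hd hL).sitesPerDir 0 : ℕ) : ℤ) n).m (mem (((PV d ℓ m K hd hL).sitesPerDir 0 : ℕ) : ℤ) n).K hd hL).sitesPerDir 0 =
        (PV d ℓ m K hd hL).sitesPerDir 0 := by
    intro m K n hn hnk
    obtain ⟨him, hiK, -⟩ := H m K n hn hnk
    have h := (period_eq (d := d) (hd := hd) (hL := hL) (m + K) 0).trans (period_eq (d := d) (hd := hd) (hL := hL) m K).symm
    rw [him, hiK]
    exact_mod_cast h
  refine ⟨a, k₀, fun _ P n => mem P n, fun _ P n => ιBm P n, h8, hk₀,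
    fun m K k _ hk => ⟨fun n hn hnk => ?_, fun n hn hnk => ?_, fun n hn hnk z => ?_, fun n hn hnk => ?_⟩⟩
  · obtain ⟨-, -, hik, hiMh, hicf, hiD, hiw, -⟩ := H m K n hn (by omega)
    refine ⟨hiD, hik, hiMh, by rw [hicf, hik], hper m K n hn (by omega), hiw⟩
  · exact_mod_cast hper m K n hn (by omega)
  · obtain ⟨-, -, -, -, -, hiD, -⟩ := H m K n hn (by omega)
    exact hiD z.1
  · obtain ⟨-, -, hik, -, hicf, -, -, hM, hN, hT, hι⟩ := H m K n hn (by omega)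
    exact ⟨hM, hN, hT, hicf, le_of_eq hik, hι⟩

end Literature.MathematicalPhysics.QuantumFieldTheory.Balaban1983to89.B8Thm2TorusMemberCatalogueThresholds

end
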